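import Mathlib
import HarnessLib
import Literature.MathematicalPhysics.StatisticalMechanics.StepOperatorAKernelSub

/-!
# `H̃₁₁ − H̃₁₀ − H̃₀₁ + H̃₀₀ = ΔΔ(A(γ))H + ΔΔ(B)K` and `‖ΔΔ(A(γ))H‖_{k,0} ≤ (δ/h²)‖H‖_{k,0}` — the PARALLELOGRAM
# (ℓ = 2) twin of `StepOperatorAKernelSub` ([ABKM19] Theorem 6.8 (6.56), Lemma 12.6 (12.51)–(12.53) at `ℓ = 2`)

`StepOperatorAKernelSub` treats the two-kernel difference `H̃_a − H̃_b` of the extracted Hamiltonian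
`H̃ = nextH D H K = A(γ_D)H + B_DK`.  The second-order two-kernel comparison of the renormalisation step in the
tuning parameter (parallelograms `q, q+y, q+z, q+y+z`; line `banach_two_kernel` of the child `TwoKernelSkBound` of the
cruxes `HypACumulant` / `HypALocalTwoPoint`, route `Summits/HubbardSuperconductivity/…/Theses/ComplexGFFStiffness`, stub
`stub_f4l2ShrinkLoc`) needs the mixed second difference of `H̃` over four step data sharing `B₀, c₀`.  Since `A(γ)H`
is AFFINE in `γ` (`stepOpA_sub_stepOpA_const/lin/quad`), the second difference of `A` is a FIRST difference at the
combined covariances, and the first-order file applies verbatim: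

* `stepOpA_secondDiff_eq` — `A(γ₁₁)H − A(γ₁₀)H − A(γ₀₁)H + A(γ₀₀)H = A(γ₁₁ − γ₁₀ + γ₀₀)H − A(γ₀₁)H`;
* **`hamNorm_stepOpA_secondDiff_abkm_le`** — torus weights: `L^{dk}|γ₁₁ − γ₁₀ − γ₀₁ + γ₀₀|_q ≤ δ` gives
  `‖ΔΔ A(γ)H‖_{k,0} ≤ (δ/h²)‖H‖_{k,0}`;
* `nextH_secondDiff_eq` — `ΔΔ H̃ = ΔΔ(A(γ_D))H + ΔΔ(B_D)K` for four step data sharing `B₀, c₀`;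
* **`hamNorm_nextH_kernel_secondDiff_le`** — `‖ΔΔ H̃‖_{k,0} ≤ (δ/h²)‖H‖_{k,0} + ‖ΔΔ(B_D)K‖_{k,0}`.

The input `δ = O(|y|₁|z|₁)` is `StepOperatorASecondDiffTorusFRD.abs_gradCov_secondDiff_le_of_torusFRD`; the `B`-term is
`StepOperatorBSecondDiff` / `StepOperatorBParaSecondDiffTorusFRD`.  Everything is proved; no named fact.

## References
* S. Adams, S. Buchholz, R. Kotecký, S. Müller, arXiv:1910.13564, Theorem 6.8 (6.55)–(6.57), Lemma 12.6 (12.51)–(12.53)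
  [AdamsBuchholzKoteckyMuller2019].
-/

noncomputable section

namespace Literature.MathematicalPhysics.StatisticalMechanics.GradientRG

open scoped BigOperators
open Finset

variable {𝕜 : Type*} [NormedField 𝕜] [NormedAlgebra ℝ 𝕜] {d M : ℕ}

/-! ## `ΔΔ A(γ)H` -/

/-- **`A(γ₁₁)H − A(γ₁₀)H − A(γ₀₁)H + A(γ₀₀)H = A(γ₁₁ − γ₁₀ + γ₀₀)H − A(γ₀₁)H`**: `A(γ)H` is affine in `γ`.
[cite: AdamsBuchholzKoteckyMuller2019, Theorem 6.8 (6.56)] -/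
theorem stepOpA_secondDiff_eq (γ₁₁ γ₁₀ γ₀₁ γ₀₀ : quadIndex d → ℝ) (H : RelevantHamiltonian 𝕜 d) :
    stepOpA γ₁₁ H - stepOpA γ₁₀ H - stepOpA γ₀₁ H + stepOpA γ₀₀ H =
      stepOpA (γ₁₁ - γ₁₀ + γ₀₀) H - stepOpA γ₀₁ H := by
  have hre : stepOpA γ₁₁ H - stepOpA γ₁₀ H - stepOpA γ₀₁ H + stepOpA γ₀₀ H =
      (stepOpA γ₁₁ H - stepOpA γ₁₀ H) - (stepOpA γ₀₁ H - stepOpA γ₀₀ H) := by abel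
  rw [hre]
  funext i
  rcases i with u | α | q
  · rw [Pi.sub_apply (stepOpA γ₁₁ H - stepOpA γ₁₀ H), stepOpA_sub_stepOpA_const, stepOpA_sub_stepOpA_const,
      stepOpA_sub_stepOpA_const]
    simp only [Pi.add_apply, Pi.sub_apply, sub_smul, add_smul, Finset.sum_sub_distrib, Finset.sum_add_distrib]
    abel
  · rw [Pi.sub_apply (stepOpA γ₁₁ H - stepOpA γ₁₀ H), stepOpA_sub_stepOpA_lin, stepOpA_sub_stepOpA_lin,
      stepOpA_sub_stepOpA_lin, sub_zero]
  · rw [Pi.sub_apply (stepOpA γ₁₁ H - stepOpA γ₁₀ H), stepOpA_sub_stepOpA_quad, stepOpA_sub_stepOpA_quad,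
      stepOpA_sub_stepOpA_quad, sub_zero]

/-- **The torus weights, `ℓ = 2`**: for `𝔥_k = fieldWt h L d k`, `R_k = L^k`, `n_k = L^{dk}` (`d ≥ 2`, `L ≥ 1`, `h > 0`),
`L^{dk}|γ₁₁ − γ₁₀ − γ₀₁ + γ₀₀|_q ≤ δ` (`δ ≥ 0`) gives `‖A(γ₁₁)H − A(γ₁₀)H − A(γ₀₁)H + A(γ₀₀)H‖_{k,0} ≤ (δ/h²)‖H‖_{k,0}`.
[cite: AdamsBuchholzKoteckyMuller2019, Theorem 6.8 (6.56) / Lemma 12.6 (ℓ = 2)] -/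
theorem hamNorm_stepOpA_secondDiff_abkm_le {L : ℕ} {h δ : ℝ} (hd : 2 ≤ d) (hL : 1 ≤ L) (hh : 0 < h)
    (hδ : 0 ≤ δ) (k : ℕ) {γ₁₁ γ₁₀ γ₀₁ γ₀₀ : quadIndex d → ℝ}
    (hγ : ∀ q, ((L ^ (d * k) : ℕ) : ℝ) * |γ₁₁ q - γ₁₀ q - γ₀₁ q + γ₀₀ q| ≤ δ) (H : RelevantHamiltonian 𝕜 d) :
    hamNorm (fieldWt h L d k) ((L : ℝ) ^ k) (L ^ (d * k))
        (stepOpA γ₁₁ H - stepOpA γ₁₀ H - stepOpA γ₀₁ H + stepOpA γ₀₀ H) ≤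
      (δ / h ^ 2) * hamNorm (fieldWt h L d k) ((L : ℝ) ^ k) (L ^ (d * k)) H := by
  rw [stepOpA_secondDiff_eq]
  refine hamNorm_stepOpA_sub_abkm_le hd hL hh hδ k (fun q => ?_) H
  have : (γ₁₁ - γ₁₀ + γ₀₀) q - γ₀₁ q = γ₁₁ q - γ₁₀ q - γ₀₁ q + γ₀₀ q := by
    simp only [Pi.add_apply, Pi.sub_apply]; ring
  rw [this]
  exact hγ q

/-! ## The parallelogram second difference of `H̃ = A_kH + B_kK` -/

/-- **`ΔΔ H̃ = ΔΔ(A(γ_D))H + ΔΔ(B_D)K`** for four step data sharing the reference block and base point (all circulants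
positive semidefinite, room for the test polynomials). [cite: AdamsBuchholzKoteckyMuller2019, Theorem 6.8 (6.55)–(6.57)] -/
theorem nextH_secondDiff_eq [NeZero M] (D₁₁ D₁₀ D₀₁ D₀₀ : StepData d M)
    (hC₁₁ : (Matrix.circulant D₁₁.𝒞).PosSemidef) (hC₁₀ : (Matrix.circulant D₁₀.𝒞).PosSemidef)
    (hC₀₁ : (Matrix.circulant D₀₁.𝒞).PosSemidef) (hC₀₀ : (Matrix.circulant D₀₀.𝒞).PosSemidef)
    (hB : D₀₀.B₀.card ≠ 0) (hroom : ∀ x ∈ D₀₀.B₀, HasRoom D₀₀.c₀ x (d / 2 + 1))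
    (hB₁₁ : D₁₁.B₀ = D₀₀.B₀) (hc₁₁ : D₁₁.c₀ = D₀₀.c₀) (hB₁₀ : D₁₀.B₀ = D₀₀.B₀) (hc₁₀ : D₁₀.c₀ = D₀₀.c₀)
    (hB₀₁ : D₀₁.B₀ = D₀₀.B₀) (hc₀₁ : D₀₁.c₀ = D₀₀.c₀)
    (H : RelevantHamiltonian ℂ d) (K : Finset (Fin d → ZMod M) → ((Fin d → ZMod M) → ℝ) → ℂ) :
    nextH D₁₁ H K - nextH D₁₀ H K - nextH D₀₁ H K + nextH D₀₀ H K =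
      (stepOpA (gradCov D₁₁.𝒞) H - stepOpA (gradCov D₁₀.𝒞) H - stepOpA (gradCov D₀₁.𝒞) H +
          stepOpA (gradCov D₀₀.𝒞) H) +
        (opB D₁₁ K - opB D₁₀ K - opB D₀₁ K + opB D₀₀ K) := by
  have hB₁₁' : D₁₁.B₀.card ≠ 0 := by rw [hB₁₁]; exact hB
  have hB₁₀' : D₁₀.B₀.card ≠ 0 := by rw [hB₁₀]; exact hB
  have hB₀₁' : D₀₁.B₀.card ≠ 0 := by rw [hB₀₁]; exact hB
  have hroom₁₁ : ∀ x ∈ D₁₁.B₀, HasRoom D₁₁.c₀ x (d / 2 + 1) := by rw [hB₁₁, hc₁₁]; exact hroom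
  have hroom₁₀ : ∀ x ∈ D₁₀.B₀, HasRoom D₁₀.c₀ x (d / 2 + 1) := by rw [hB₁₀, hc₁₀]; exact hroom
  have hroom₀₁ : ∀ x ∈ D₀₁.B₀, HasRoom D₀₁.c₀ x (d / 2 + 1) := by rw [hB₀₁, hc₀₁]; exact hroom
  rw [nextH_eq D₁₁ hC₁₁ hB₁₁' hroom₁₁ H K, nextH_eq D₁₀ hC₁₀ hB₁₀' hroom₁₀ H K,
    nextH_eq D₀₁ hC₀₁ hB₀₁' hroom₀₁ H K, nextH_eq D₀₀ hC₀₀ hB hroom H K]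
  abel

/-- **`‖H̃₁₁ − H̃₁₀ − H̃₀₁ + H̃₀₀‖_{k,0} ≤ (δ/h²)‖H‖_{k,0} + ‖B₁₁K − B₁₀K − B₀₁K + B₀₀K‖_{k,0}`** at the torus weights of
scale `k`, from `L^{dk}|ΔΔ γ_q| ≤ δ` (four step data sharing `B₀, c₀`).
[cite: AdamsBuchholzKoteckyMuller2019, Lemma 12.6 (12.51)–(12.53), ℓ = 2] -/
theorem hamNorm_nextH_kernel_secondDiff_le [NeZero M] {L : ℕ} {h δ : ℝ} (hd : 2 ≤ d) (hL : 1 ≤ L) (hh : 0 < h)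
    (hδ : 0 ≤ δ) (k : ℕ) (D₁₁ D₁₀ D₀₁ D₀₀ : StepData d M)
    (hC₁₁ : (Matrix.circulant D₁₁.𝒞).PosSemidef) (hC₁₀ : (Matrix.circulant D₁₀.𝒞).PosSemidef)
    (hC₀₁ : (Matrix.circulant D₀₁.𝒞).PosSemidef) (hC₀₀ : (Matrix.circulant D₀₀.𝒞).PosSemidef)
    (hB : D₀₀.B₀.card ≠ 0) (hroom : ∀ x ∈ D₀₀.B₀, HasRoom D₀₀.c₀ x (d / 2 + 1))
    (hB₁₁ : D₁₁.B₀ = D₀₀.B₀) (hc₁₁ : D₁₁.c₀ = D₀₀.c₀) (hB₁₀ : D₁₀.B₀ = D₀₀.B₀) (hc₁₀ : D₁₀.c₀ = D₀₀.c₀)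
    (hB₀₁ : D₀₁.B₀ = D₀₀.B₀) (hc₀₁ : D₀₁.c₀ = D₀₀.c₀)
    (hγ : ∀ q, ((L ^ (d * k) : ℕ) : ℝ) *
      |gradCov D₁₁.𝒞 q - gradCov D₁₀.𝒞 q - gradCov D₀₁.𝒞 q + gradCov D₀₀.𝒞 q| ≤ δ)
    (H : RelevantHamiltonian ℂ d) (K : Finset (Fin d → ZMod M) → ((Fin d → ZMod M) → ℝ) → ℂ) :
    hamNorm (fieldWt h L d k) ((L : ℝ) ^ k) (L ^ (d * k))
        (nextH D₁₁ H K - nextH D₁₀ H K - nextH D₀₁ H K + nextH D₀₀ H K) ≤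
      (δ / h ^ 2) * hamNorm (fieldWt h L d k) ((L : ℝ) ^ k) (L ^ (d * k)) H +
        hamNorm (fieldWt h L d k) ((L : ℝ) ^ k) (L ^ (d * k))
          (opB D₁₁ K - opB D₁₀ K - opB D₀₁ K + opB D₀₀ K) := by
  have hL0 : (0 : ℝ) < L := by exact_mod_cast (show 0 < L by omega)
  rw [nextH_secondDiff_eq D₁₁ D₁₀ D₀₁ D₀₀ hC₁₁ hC₁₀ hC₀₁ hC₀₀ hB hroom hB₁₁ hc₁₁ hB₁₀ hc₁₀ hB₀₁ hc₀₁ H K]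
  refine (hamNorm_add_le (fieldWt_pos hh hL0 d k).le (by positivity) _ _ _).trans ?_
  exact add_le_add (hamNorm_stepOpA_secondDiff_abkm_le hd hL hh hδ k hγ H) le_rfl

end Literature.MathematicalPhysics.StatisticalMechanics.GradientRG

end
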